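import Summits.Parity.GeneralizedHardyLittlewood.Theorems.PrimeLevelFamEdgeMomentsBeyondDiagonalDiagDecorM4Coprime
import HarnessLib

/-!
# Route `PrimeLevelFamEdge`, crux K_A `MomentsBeyondDiagonal` (stmt-Parity-20007), line «petersson_layers» v4, stub `stub_diag`:
# **the `P₂²`-decorated coprime Selberg sum, packaged:
# `Σ_{k≤y,(k,n)=1}τ(k)W(k)P₂(k)²logᶜ(y/k) = −8·(c!/(c+2)!)·E_n·log^{c+2}y + O(D(n)(1+κ(n))(1+log y)^{c+1})`** (`c ≥ 2`)

The two halves of `…DiagDecorM4Coprime.abs_coprimeSumPow_M4_le` separately: by the double peel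
`…DiagDecorPrimePowPeel.sum_copTauW_mul_primeSq_sq_eq`, the `P₂²`-sum is the `P₄`-peel
(`…DiagDecorPrimePowTwo.abs_coprimeSumPow_primePow_add_le_of_two_le 3`: `−2c(c−1)(3!(c−2)!/(c+2)!)E_n log^{c+2}y = −12·(c!/(c+2)!)…`)
plus the cross term (`…DiagDecorPrimeSqCross.abs_primeSqCross_sub_le`: `+4·(1!c!/(c+2)!)E_n log^{c+2}y`): total `−8·c!/(c+2)!`
(= `−8/((c+1)(c+2))`). Needed as the INNER engine of the `P₂·P₂²` cross term of the `P₂³` family of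
`M₆ = τ(15P₂³ − 30P₂P₄ + 16P₆)` (`…DiagDecorWeightRungThree`; coefficients in units `E_n log^{c+4}y/((c+1)(c+2)(c+3)(c+4))`:
`P₆ ↦ −240`, `P₂P₄ ↦ −216`, `P₂³ ↦ −176`, and `15(−176) − 30(−216) + 16(−240) = 0`).

* `p2sq_factorial_identity` — `2c(c−1)·(3!(c−2)!/(c−2+3+1)!) − 4·(1!c!/(c+1+1)!) = 8·(c!/(c+1+1)!)` (`c ≥ 2`);
* `abs_coprimeSumPow_primeSqSq_add_le` — **the displayed asymptotic**.

Def-free; theorems only. Helper `--supports stmt-Parity-20007`; closes nothing; K_A, K_B and the Parity summit are NOT proved;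
nothing about Landau–Siegel zeros.

## References
* E. Kowalski, P. Michel, J. VanderKam, J. reine angew. Math. 526 (2000), (23)–(28) pp. 13–15 and Prop. 5.1 p. 18.
  [cite: KowalskiMichelVanderKam2000, (23)–(28) — derivation (prime-power-log decorations of the Selberg coordinates)]
-/

noncomputable section

open scoped Real
open Finset ArithmeticFunction

namespace Summit.Parity.GeneralizedHardyLittlewood.Theorems.MomentsBeyondDiagonal.DiagKernel

open Literature.NumberTheory.LFunctions Literature.NumberTheory.LFunctions.KMV2000
open SelbergCoord (kappa)
open Summit.Parity.GeneralizedHardyLittlewood.Theorems.BeyondDiagonalBeatsQuarter.KernelFormXSq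
  (copTauW mainConst divWeight divWeight_nonneg mainConst_nonneg)
open Summit.Parity.GeneralizedHardyLittlewood.Theorems.MomentsBeyondDiagonal.DiagLines
  (sum_copTauW_mul_mul_sum_primeFactors_eq sum_copTauW_mul_primeSq_sq_eq)

/-- The main coefficients of the `P₂²`-decoration: `2c(c−1)·(3!(c−2)!/(c−2+3+1)!) − 4·(1!c!/(c+1+1)!) = 8·(c!/(c+1+1)!)`
for `c ≥ 2` (`12 − 4 = 8` in units `c!/(c+2)!`). [folklore] -/
theorem p2sq_factorial_identity {c : ℕ} (hc : 2 ≤ c) :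
    2 * ((c : ℝ) * ((c : ℝ) - 1)) * (((Nat.factorial 3 : ℕ) : ℝ) * (c - 2).factorial / (c - 2 + 3 + 1).factorial) -
        4 * (((Nat.factorial 1 : ℕ) : ℝ) * c.factorial / (c + 1 + 1).factorial) =
      8 * ((c.factorial : ℝ) / (c + 1 + 1).factorial) := by
  have h := m4_factorial_identity hc
  have e : c - 2 + 3 + 1 = c + 1 + 1 := by omega
  rw [e] at h ⊢
  rw [h, show Nat.factorial 1 = 1 from rfl]
  push_cast
  ring

/-- **The `P₂²`-decorated coprime Selberg sum** (`c ≥ 2`): there is `C` with, for all `n ≥ 1`, `y ≥ 1`,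
`|Σ_{k≤y} a_n(k)·logᶜ(y/k)·P₂(k)² + 8·(c!/(c+2)!)·E_n·log^{c+2}y| ≤ C·D(n)(1+κ(n))(1+log y)^{c+1}`.
[cite: KowalskiMichelVanderKam2000, (23)–(28) — derivation] -/
theorem abs_coprimeSumPow_primeSqSq_add_le {c : ℕ} (hc : 2 ≤ c) :
    ∃ C : ℝ, 0 < C ∧ ∀ n : ℕ, n ≠ 0 → ∀ y : ℝ, 1 ≤ y →
      |∑ k ∈ Icc 1 ⌊y⌋₊, copTauW n k * Real.log (y / k) ^ c * (∑ p ∈ k.primeFactors, Real.log p ^ 2) ^ 2 +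
          8 * ((c.factorial : ℝ) / (c + 1 + 1).factorial) * mainConst n * Real.log y ^ (c + 1 + 1)| ≤
        C * divWeight n * (1 + kappa n) * (1 + Real.log y) ^ (c + 1) := by
  obtain ⟨C₁, hC₁, h₁⟩ := abs_coprimeSumPow_primePow_add_le_of_two_le 3 hc
  obtain ⟨C₂, hC₂, h₂⟩ := abs_primeSqCross_sub_le hc
  refine ⟨C₁ + C₂, by positivity, fun n hn y hy ↦ ?_⟩
  set N := ⌊y⌋₊ with hN
  have hP4 := h₁ n hn y hy
  have hX := h₂ n hn y hy
  have e34 : c - 2 + 3 = c + 1 := by omega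
  rw [show ((3 : ℕ) + 1) = 4 from rfl] at hP4
  rw [e34] at hP4
  -- `Σ aG·P₂² = Σ aG·P₄ + CROSS`
  have hpeel4 := sum_copTauW_mul_mul_sum_primeFactors_eq n N (fun k : ℕ ↦ Real.log (y / k) ^ c)
    (fun p : ℕ ↦ Real.log p ^ 4)
  have hsq := sum_copTauW_mul_primeSq_sq_eq n N 2 (fun k : ℕ ↦ Real.log (y / k) ^ c)
  beta_reduce at hpeel4 hsq
  rw [show 2 * 2 = 4 from rfl, ← hpeel4] at hsq
  have hdec : ∑ k ∈ Icc 1 N, copTauW n k * Real.log (y / k) ^ c * (∑ p ∈ k.primeFactors, Real.log p ^ 2) ^ 2 =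
      (∑ k ∈ Icc 1 N, copTauW n k * Real.log (y / k) ^ c * ∑ p ∈ k.primeFactors, Real.log p ^ 4) +
        ∑ p ∈ (Icc 1 N).filter Nat.Prime, Real.log p ^ 2 * copTauW n p *
          ∑ k ∈ Icc 1 (N / p), copTauW (n * p) k *
            (Real.log (y / ((p * k : ℕ) : ℝ)) ^ c * ∑ q ∈ k.primeFactors, Real.log q ^ 2) := by
    rw [← hsq]
    exact Finset.sum_congr rfl fun k _ ↦ by ring
  rw [hdec]
  -- the main terms combine: `12 − 4 = 8`
  have hid := p2sq_factorial_identity hc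
  have e341 : c - 2 + 3 + 1 = c + 1 + 1 := by omega
  rw [e341] at hid
  have key : ∀ {A X M₁ M₂ M : ℝ}, M₁ - M₂ = M → A + X + M = (A + M₁) + (X - M₂) := by
    intro A X M₁ M₂ M h; rw [← h]; ring
  rw [key (M₁ := 2 * ((c : ℝ) * ((c : ℝ) - 1)) * (((Nat.factorial 3 : ℕ) : ℝ) * (c - 2).factorial / (c + 1 + 1).factorial) *
      mainConst n * Real.log y ^ (c + 1 + 1))
    (M₂ := 4 * (((Nat.factorial 1 : ℕ) : ℝ) * c.factorial / (c + 1 + 1).factorial) * mainConst n * Real.log y ^ (c + 1 + 1))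
    (by rw [show 2 * ((c : ℝ) * ((c : ℝ) - 1)) * (((Nat.factorial 3 : ℕ) : ℝ) * (c - 2).factorial / (c + 1 + 1).factorial) *
        mainConst n * Real.log y ^ (c + 1 + 1) -
        4 * (((Nat.factorial 1 : ℕ) : ℝ) * c.factorial / (c + 1 + 1).factorial) * mainConst n * Real.log y ^ (c + 1 + 1) =
        (2 * ((c : ℝ) * ((c : ℝ) - 1)) * (((Nat.factorial 3 : ℕ) : ℝ) * (c - 2).factorial / (c + 1 + 1).factorial) -
          4 * (((Nat.factorial 1 : ℕ) : ℝ) * c.factorial / (c + 1 + 1).factorial)) *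
          (mainConst n * Real.log y ^ (c + 1 + 1)) by ring, hid]; ring)]
  calc _ ≤ |∑ k ∈ Icc 1 N, copTauW n k * Real.log (y / k) ^ c * ∑ p ∈ k.primeFactors, Real.log p ^ 4 +
          2 * ((c : ℝ) * ((c : ℝ) - 1)) * (((Nat.factorial 3 : ℕ) : ℝ) * (c - 2).factorial / (c + 1 + 1).factorial) *
            mainConst n * Real.log y ^ (c + 1 + 1)| +
        |∑ p ∈ (Icc 1 N).filter Nat.Prime, Real.log p ^ 2 * copTauW n p *
          ∑ k ∈ Icc 1 (N / p), copTauW (n * p) k *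
            (Real.log (y / ((p * k : ℕ) : ℝ)) ^ c * ∑ q ∈ k.primeFactors, Real.log q ^ 2) -
          4 * (((Nat.factorial 1 : ℕ) : ℝ) * c.factorial / (c + 1 + 1).factorial) * mainConst n * Real.log y ^ (c + 1 + 1)| :=
        abs_add_le _ _
    _ ≤ C₁ * divWeight n * (1 + kappa n) * (1 + Real.log y) ^ (c + 1) +
        C₂ * divWeight n * (1 + kappa n) * (1 + Real.log y) ^ (c + 1) := add_le_add hP4 hX
    _ = (C₁ + C₂) * divWeight n * (1 + kappa n) * (1 + Real.log y) ^ (c + 1) := by ring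

end Summit.Parity.GeneralizedHardyLittlewood.Theorems.MomentsBeyondDiagonal.DiagKernel

end
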